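import Literature.Analysis.FluidPDE.ElgindiEllipticEnergySpace
import Literature.Analysis.FluidPDE.ElgindiAngularDataBound
import Literature.Analysis.FluidPDE.ElgindiPolarIBPTwo
import Mathlib.MeasureTheory.Integral.IntervalIntegral.IntegrationByParts
import HarnessLib

/-!
# Green's identity for Elgindi's polar elliptic operator: `(L(Ψ), Φ)_{L²} = B(JΨ, JΦ)`
([Elgindi2021] §7, weak form of (PolarBSL))

Topic `Literature/Analysis/FluidPDE`. Proof file (everything proved, no definitions, no named
facts) on the proof path of the named fact
`Literature.Analysis.FluidPDE.Elgindi.ElgindiGhoulMasmoudi2021_stabilityCore`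
(`ElgindiStabilityDecomposition.lean`). T. M. Elgindi, Ann. of Math. 194 (2021) =
arXiv:1904.04795, §7.1, proof of Proposition 7.1, Step 2 (p. 19 of the held text):

> "Multiplying (PolarBSL) by `Ψ` and integrating we get
> `α²|R∂_RΨ|² − α²|Ψ|² + (α(5+α)/2)|Ψ|² + |∂_θΨ|² − 6|Ψ|² + ½|sec(θ)Ψ|² = (F,Ψ)`."

The polarized form of this computation (multiply by a second profile `Φ = cos θχ₂` vanishing on
`θ = 0` instead of by `Ψ` itself) is the weak formulation on which the variational existence proof
rests (`ElgindiEllipticEnergySpace.lean`): for `Ψ = cos θχ₁` (`χ₁ ∈ C²`) and `Φ = cos θχ₂`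
(`χ₂ ∈ C¹`, `χ₂(R,0) = 0`), both compactly supported inside `R > 0`,

  `∫∫_strip L(Ψ)·Φ dRdθ = ∫∫ [α²R∂_RΨ·R∂_RΦ + (α−5)·αR∂_RΨ·Φ + ∂_θΨ∂_θΦ − tan θΨ·∂_θΦ − 6ΨΦ] = B(Jχ₁, Jχ₂)`

(`integral_strip_ellipticOp_mul_eq_energyForm`), by three integrations by parts: in `R` for
`−α²R²∂_{RR}` (`integral_Ioi_neg_sq_mul_deriv2_mul_bilin`), in `θ` for `−∂_θθ`
(`integral_mul_deriv2_dirichlet` of `ElgindiPolarIBPTwo.lean`) and for `∂_θ(tan θΨ) = ∂_θ(sin θχ₁)`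
(`integral_Ioo_deriv_sinMul_mul_cosMul`).
-/

noncomputable section

open MeasureTheory Set Real Filter Function
open _root_.Topology
open scoped InnerProductSpace

namespace Literature.Analysis.FluidPDE

namespace Elgindi

/-! ### One-dimensional integrations by parts (bilinear) -/

/-- **Radial IBP, bilinear**: `∫₀^∞ −(R²u″)v = ∫₀^∞ (Ru′)(Rv′) + 2∫₀^∞ (Ru′)v` for `u ∈ C²`, `v ∈ C¹`,
both vanishing below some `a > 0`, `v` vanishing beyond `b`. [folklore] -/
theorem integral_Ioi_neg_sq_mul_deriv2_mul_bilin {u v : ℝ → ℝ} (hu : ContDiff ℝ 2 u) (hv : ContDiff ℝ 1 v)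
    {a b : ℝ} (ha : 0 < a) (hua : ∀ R < a, u R = 0) (hva : ∀ R < a, v R = 0) (hvb : ∀ R, b < R → v R = 0) :
    ∫ R in Ioi (0:ℝ), -(R ^ 2 * deriv (deriv u) R) * v R =
      (∫ R in Ioi (0:ℝ), (R * deriv u R) * (R * deriv v R)) + 2 * ∫ R in Ioi (0:ℝ), (R * deriv u R) * v R := by
  have hu1 : ContDiff ℝ 1 (deriv u) := by have := hu.iterate_deriv' 1 1; simpa using this
  have hdu1 : Differentiable ℝ (deriv u) := hu1.differentiable (by simp)
  have hdv : Differentiable ℝ v := hv.differentiable (by simp)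
  have cu' : Continuous (deriv u) := hu1.continuous
  have cu'' : Continuous (deriv (deriv u)) := hu1.continuous_deriv le_rfl
  have cv : Continuous v := hv.continuous
  have cv' : Continuous (deriv v) := hv.continuous_deriv le_rfl
  -- derivatives vanish below `a` and beyond `b`
  have hu'a : ∀ R < a, deriv u R = 0 := fun R hR => by
    have h0 : u =ᶠ[𝓝 R] fun _ => 0 := Filter.eventuallyEq_of_mem (Iio_mem_nhds hR) fun x hx => hua x hx
    rw [h0.deriv_eq, deriv_const]
  have hv'b : ∀ R, b < R → deriv v R = 0 := fun R hR => by
    have h0 : v =ᶠ[𝓝 R] fun _ => 0 := Filter.eventuallyEq_of_mem (Ioi_mem_nhds hR) fun x hx => hvb x hx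
    rw [h0.deriv_eq, deriv_const]
  -- compact support of anything vanishing outside `[a, b]`
  have csupp : ∀ {g : ℝ → ℝ}, (∀ R < a, g R = 0) → (∀ R, b < R → g R = 0) → HasCompactSupport g := fun {g} h1 h2 =>
    HasCompactSupport.of_support_subset_isCompact (isCompact_Icc (a := a) (b := b)) fun R hR => by
      by_contra h
      simp only [Set.mem_Icc, not_and_or, not_le] at h
      rcases h with h | h
      · exact hR (h1 R h)
      · exact hR (h2 R h)
  -- `H = R² u' v`, `H' = 2R u' v + R² u'' v + R² u' v'`
  have hH : ∀ R, HasDerivAt (fun R => R ^ 2 * deriv u R * v R)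
      (2 * R * deriv u R * v R + R ^ 2 * deriv (deriv u) R * v R + R ^ 2 * deriv u R * deriv v R) R := by
    intro R
    have h1 : HasDerivAt (fun R : ℝ => R ^ 2) (2 * R) R := by simpa using (hasDerivAt_pow 2 R)
    have := (h1.fun_mul (hdu1 R).hasDerivAt).fun_mul (hdv R).hasDerivAt
    refine this.congr_deriv ?_
    ring
  have hHs : HasCompactSupport fun R => R ^ 2 * deriv u R * v R := csupp (fun R hR => by simp [hva R hR]) fun R hR => by simp [hvb R hR]
  have cH' : Continuous fun R => 2 * R * deriv u R * v R + R ^ 2 * deriv (deriv u) R * v R + R ^ 2 * deriv u R * deriv v R := by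
    fun_prop
  have sH' : HasCompactSupport fun R => 2 * R * deriv u R * v R + R ^ 2 * deriv (deriv u) R * v R + R ^ 2 * deriv u R * deriv v R :=
    csupp (fun R hR => by simp [hva R hR, hu'a R hR]) fun R hR => by simp [hvb R hR, hv'b R hR]
  have key : ∫ R, (2 * R * deriv u R * v R + R ^ 2 * deriv (deriv u) R * v R + R ^ 2 * deriv u R * deriv v R) = 0 := by
    have h0 : Tendsto (fun R => R ^ 2 * deriv u R * v R) (cocompact ℝ) (𝓝 0) := hHs.is_zero_at_infty
    have := integral_of_hasDerivAt_of_tendsto hH (cH'.integrable_of_hasCompactSupport sH') (h0.mono_left atBot_le_cocompact)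
      (h0.mono_left atTop_le_cocompact)
    rw [sub_zero] at this
    exact this
  -- all integrands vanish on `(−∞, 0]`, so the integrals over `ℝ` are integrals over `(0, ∞)`
  have toIoi : ∀ {g : ℝ → ℝ}, (∀ R < a, g R = 0) → ∫ R, g R = ∫ R in Ioi 0, g R := fun {g} hg => by
    rw [← setIntegral_eq_integral_of_forall_compl_eq_zero (s := Ioi (0:ℝ)) fun R hR => hg R ?_]
    simp only [Set.mem_Ioi, not_lt] at hR
    exact hR.trans_lt ha
  have i1 : Integrable fun R => 2 * R * deriv u R * v R :=
    (by fun_prop : Continuous fun R => 2 * R * deriv u R * v R).integrable_of_hasCompactSupport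
      (csupp (fun R hR => by simp [hva R hR]) fun R hR => by simp [hvb R hR])
  have i2 : Integrable fun R => R ^ 2 * deriv (deriv u) R * v R :=
    (by fun_prop : Continuous fun R => R ^ 2 * deriv (deriv u) R * v R).integrable_of_hasCompactSupport
      (csupp (fun R hR => by simp [hva R hR]) fun R hR => by simp [hvb R hR])
  have i3 : Integrable fun R => R ^ 2 * deriv u R * deriv v R :=
    (by fun_prop : Continuous fun R => R ^ 2 * deriv u R * deriv v R).integrable_of_hasCompactSupport
      (csupp (fun R hR => by simp [hu'a R hR]) fun R hR => by simp [hv'b R hR])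
  have i12 : Integrable fun R => 2 * R * deriv u R * v R + R ^ 2 * deriv (deriv u) R * v R := i1.add i2
  rw [integral_add i12 i3, integral_add i1 i2] at key
  rw [toIoi (fun R hR => by simp [hva R hR]), toIoi (fun R hR => by simp [hva R hR]), toIoi (fun R hR => by simp [hu'a R hR])] at key
  have e1 : ∫ R in Ioi (0:ℝ), -(R ^ 2 * deriv (deriv u) R) * v R = -∫ R in Ioi (0:ℝ), R ^ 2 * deriv (deriv u) R * v R := by
    rw [← MeasureTheory.integral_neg]; exact integral_congr_ae (ae_of_all _ fun R => by ring)
  have e2 : ∫ R in Ioi (0:ℝ), (R * deriv u R) * (R * deriv v R) = ∫ R in Ioi (0:ℝ), R ^ 2 * deriv u R * deriv v R :=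
    integral_congr_ae (ae_of_all _ fun R => by ring)
  have e3 : ∫ R in Ioi (0:ℝ), (R * deriv u R) * v R = (1/2) * ∫ R in Ioi (0:ℝ), 2 * R * deriv u R * v R := by
    rw [← MeasureTheory.integral_const_mul]; exact integral_congr_ae (ae_of_all _ fun R => by ring)
  rw [e1, e2, e3]
  linarith

/-- **The `−∂_θθ` term, bilinear**: `∫₀^{π/2} −u″w = ∫₀^{π/2} u′w′` for `u ∈ C²`, `w ∈ C¹` with
`w(0) = w(π/2) = 0`. [folklore] -/
theorem integral_Ioo_neg_deriv2_mul_bilin {u w : ℝ → ℝ} (hu : ContDiff ℝ 2 u) (hw : ContDiff ℝ 1 w)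
    (hw0 : w 0 = 0) (hw1 : w (π / 2) = 0) :
    ∫ θ in Ioo 0 (π / 2), -deriv (deriv u) θ * w θ = ∫ θ in Ioo 0 (π / 2), deriv u θ * deriv w θ := by
  have hb : (0:ℝ) ≤ π / 2 := by positivity
  have h := integral_mul_deriv2_dirichlet hw hu hw0 hw1
  rw [intervalIntegral.integral_of_le hb, intervalIntegral.integral_of_le hb, integral_Ioc_eq_integral_Ioo,
    integral_Ioc_eq_integral_Ioo] at h
  have e1 : ∫ θ in Ioo 0 (π / 2), -deriv (deriv u) θ * w θ = -∫ θ in Ioo 0 (π / 2), w θ * deriv (deriv u) θ := by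
    rw [← MeasureTheory.integral_neg]; exact integral_congr_ae (ae_of_all _ fun θ => by ring)
  have e2 : ∫ θ in Ioo 0 (π / 2), deriv u θ * deriv w θ = ∫ θ in Ioo 0 (π / 2), deriv w θ * deriv u θ :=
    integral_congr_ae (ae_of_all _ fun θ => by ring)
  rw [e1, e2, h]; ring

/-- **The `tan` term, bilinear**: `∫₀^{π/2} (sin θχ₁)′(cos θχ₂) = −∫₀^{π/2} (sin θχ₁)(cos θχ₂)′` for
`χ₁, χ₂ ∈ C¹(ℝ)` (boundary terms: `sin 0 = 0`, `cos(π/2) = 0`). [folklore] -/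
theorem integral_Ioo_deriv_sinMul_mul_cosMul {χ₁ χ₂ : ℝ → ℝ} (h1 : ContDiff ℝ 1 χ₁) (h2 : ContDiff ℝ 1 χ₂) :
    ∫ θ in Ioo 0 (π / 2), deriv (fun θ => Real.sin θ * χ₁ θ) θ * (Real.cos θ * χ₂ θ) =
      -∫ θ in Ioo 0 (π / 2), (Real.sin θ * χ₁ θ) * deriv (fun θ => Real.cos θ * χ₂ θ) θ := by
  have hb : (0:ℝ) ≤ π / 2 := by positivity
  have hd1 : Differentiable ℝ χ₁ := h1.differentiable (by simp)
  have hd2 : Differentiable ℝ χ₂ := h2.differentiable (by simp)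
  have c1 : Continuous χ₁ := h1.continuous
  have c2 : Continuous χ₂ := h2.continuous
  have c1' : Continuous (deriv χ₁) := h1.continuous_deriv le_rfl
  have c2' : Continuous (deriv χ₂) := h2.continuous_deriv le_rfl
  have hu : ∀ θ ∈ uIcc (0:ℝ) (π / 2), HasDerivAt (fun θ => Real.sin θ * χ₁ θ) (Real.cos θ * χ₁ θ + Real.sin θ * deriv χ₁ θ) θ :=
    fun θ _ => (Real.hasDerivAt_sin θ).fun_mul (hd1 θ).hasDerivAt
  have hv : ∀ θ ∈ uIcc (0:ℝ) (π / 2), HasDerivAt (fun θ => Real.cos θ * χ₂ θ) (-Real.sin θ * χ₂ θ + Real.cos θ * deriv χ₂ θ) θ :=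
    fun θ _ => (Real.hasDerivAt_cos θ).fun_mul (hd2 θ).hasDerivAt
  have hu' : IntervalIntegrable (fun θ => Real.cos θ * χ₁ θ + Real.sin θ * deriv χ₁ θ) volume 0 (π / 2) :=
    (by fun_prop : Continuous fun θ => Real.cos θ * χ₁ θ + Real.sin θ * deriv χ₁ θ).intervalIntegrable _ _
  have hv' : IntervalIntegrable (fun θ => -Real.sin θ * χ₂ θ + Real.cos θ * deriv χ₂ θ) volume 0 (π / 2) :=
    (by fun_prop : Continuous fun θ => -Real.sin θ * χ₂ θ + Real.cos θ * deriv χ₂ θ).intervalIntegrable _ _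
  have key := intervalIntegral.integral_mul_deriv_eq_deriv_mul hu hv hu' hv'
  simp only [Real.sin_zero, zero_mul, Real.cos_pi_div_two, sub_zero, mul_zero, zero_sub] at key
  have ed1 : ∀ θ, deriv (fun θ => Real.sin θ * χ₁ θ) θ = Real.cos θ * χ₁ θ + Real.sin θ * deriv χ₁ θ := fun θ =>
    ((Real.hasDerivAt_sin θ).fun_mul (hd1 θ).hasDerivAt).deriv
  have ed2 : ∀ θ, deriv (fun θ => Real.cos θ * χ₂ θ) θ = -Real.sin θ * χ₂ θ + Real.cos θ * deriv χ₂ θ := fun θ =>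
    ((Real.hasDerivAt_cos θ).fun_mul (hd2 θ).hasDerivAt).deriv
  simp only [ed1, ed2]
  rw [← integral_Ioc_eq_integral_Ioo, ← intervalIntegral.integral_of_le hb, ← integral_Ioc_eq_integral_Ioo,
    ← intervalIntegral.integral_of_le hb]
  linarith [key]

/-! ### The Green identity on the strip -/

set_option maxHeartbeats 1600000 in
/-- **`∫∫_strip L(Ψ)Φ = ∫∫ [α²R∂_RΨR∂_RΦ + (α−5)αR∂_RΨΦ + ∂_θΨ∂_θΦ − tan θΨ∂_θΦ − 6ΨΦ]`** for
`Ψ = cos θχ₁` (`χ₁ ∈ C²`), `Φ = cos θχ₂` (`χ₂ ∈ C¹`, `χ₂(R,0) = 0`), both compactly supported inside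
`R > 0`; in the notation of `ElgindiEllipticEnergySpace.lean` the right-hand side is the integrand of
`B(Jχ₁, Jχ₂)`. [cite: Elgindi2021, §7.1 proof of Proposition 7.1, Step 2 (p. 19 of arXiv:1904.04795)] -/
theorem integral_strip_ellipticOp_mul_eq_weak (α : ℝ) {χ₁ χ₂ : ℝ → ℝ → ℝ} (h1 : ContDiff ℝ 2 (uncurry χ₁))
    (hs1 : HasCompactSupport (uncurry χ₁)) (hpos1 : ∀ p ∈ tsupport (uncurry χ₁), 0 < p.1)
    (h2 : ContDiff ℝ 1 (uncurry χ₂)) (hs2 : HasCompactSupport (uncurry χ₂)) (hpos2 : ∀ p ∈ tsupport (uncurry χ₂), 0 < p.1)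
    (h20 : ∀ R, χ₂ R 0 = 0) {Ψ : ℝ → ℝ → ℝ} (hΨ : Ψ = fun R θ => Real.cos θ * χ₁ R θ) :
    ∫ p in strip, ellipticOp α Ψ p.1 p.2 * graphFn α χ₂ 0 p =
      ∫ p in strip, (graphFn α χ₁ 1 p * graphFn α χ₂ 1 p + (α - 5) * (graphFn α χ₁ 1 p * graphFn α χ₂ 0 p) +
        graphFn α χ₁ 2 p * graphFn α χ₂ 2 p - graphFn α χ₁ 3 p * graphFn α χ₂ 2 p - 6 * (graphFn α χ₁ 0 p * graphFn α χ₂ 0 p)) := by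
  ----------------------------------------------------------------
  -- regularity and support
  ----------------------------------------------------------------
  have h11 : ContDiff ℝ 1 (uncurry χ₁) := h1.of_le (by norm_num)
  have hΨ2 : ContDiff ℝ 2 (uncurry Ψ) := by rw [hΨ]; exact contDiff_cosProfile h1
  have hΨs : HasCompactSupport (uncurry Ψ) := by rw [hΨ]; exact hasCompactSupport_cosProfile hs1
  obtain ⟨Φ, hΦ⟩ : ∃ Φ : ℝ → ℝ → ℝ, Φ = fun R θ => Real.cos θ * χ₂ R θ := ⟨_, rfl⟩
  have hΦ1 : ContDiff ℝ 1 (uncurry Φ) := by rw [hΦ]; exact contDiff_cosProfile h2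
  have hΦs : HasCompactSupport (uncurry Φ) := by rw [hΦ]; exact hasCompactSupport_cosProfile hs2
  have hdzΨ : ContDiff ℝ 1 (uncurry (dz Ψ)) := contDiff_dz_of_contDiff (n := 1) hΨ2
  have hdθΨ : ContDiff ℝ 1 (uncurry (dθ Ψ)) := contDiff_dθ_of_contDiff (n := 1) hΨ2
  have cΨ : Continuous fun p : ℝ × ℝ => Ψ p.1 p.2 := hΨ2.continuous
  have cΦ : Continuous fun p : ℝ × ℝ => Φ p.1 p.2 := hΦ1.continuous
  have cχ1 : Continuous fun p : ℝ × ℝ => χ₁ p.1 p.2 := h1.continuous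
  have cdzΨ : Continuous fun p : ℝ × ℝ => dz Ψ p.1 p.2 := hdzΨ.continuous
  have cdz2Ψ : Continuous fun p : ℝ × ℝ => dz (dz Ψ) p.1 p.2 := (contDiff_dz_of_contDiff (n := 0) hdzΨ).continuous
  have cdθΨ : Continuous fun p : ℝ × ℝ => dθ Ψ p.1 p.2 := hdθΨ.continuous
  have cdθ2Ψ : Continuous fun p : ℝ × ℝ => dθ (dθ Ψ) p.1 p.2 := (contDiff_dθ_of_contDiff (n := 0) hdθΨ).continuous
  have cdzΦ : Continuous fun p : ℝ × ℝ => dz Φ p.1 p.2 := (contDiff_dz_of_contDiff (n := 0) hΦ1).continuous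
  have cdθΦ : Continuous fun p : ℝ × ℝ => dθ Φ p.1 p.2 := (contDiff_dθ_of_contDiff (n := 0) hΦ1).continuous
  have sΦ : HasCompactSupport fun p : ℝ × ℝ => Φ p.1 p.2 := hΦs
  have sdθΦ : HasCompactSupport fun p : ℝ × ℝ => dθ Φ p.1 p.2 := hasCompactSupport_dθ_of hΦs
  have sdzΦ : HasCompactSupport fun p : ℝ × ℝ => dz Φ p.1 p.2 := hasCompactSupport_dz hΦs
  -- Dirichlet data and vanishing in `R`
  have hΦ0 : ∀ R, Φ R 0 = 0 := fun R => by rw [hΦ]; simp [h20 R]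
  have hΦ1' : ∀ R, Φ R (π / 2) = 0 := fun R => by rw [hΦ]; simp
  have hΨsub : tsupport (uncurry Ψ) ⊆ tsupport (uncurry χ₁) :=
    tsupport_subset_of_eq_zero (X := uncurry χ₁) (g := uncurry Ψ) fun q hq => by
      show Ψ q.1 q.2 = 0
      rw [hΨ]; simp [show χ₁ q.1 q.2 = 0 from hq]
  have hΦsub : tsupport (uncurry Φ) ⊆ tsupport (uncurry χ₂) :=
    tsupport_subset_of_eq_zero (X := uncurry χ₂) (g := uncurry Φ) fun q hq => by
      show Φ q.1 q.2 = 0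
      rw [hΦ]; simp [show χ₂ q.1 q.2 = 0 from hq]
  obtain ⟨a₁, ha₁, hva₁⟩ := exists_pos_forall_fst_lt_eq_zero hΨs fun p hp => hpos1 p (hΨsub hp)
  obtain ⟨a₂, ha₂, hva₂⟩ := exists_pos_forall_fst_lt_eq_zero hΦs fun p hp => hpos2 p (hΦsub hp)
  obtain ⟨b, hb⟩ := exists_forall_le_eq_zero hΦs
  set a : ℝ := min a₁ a₂ with ha_def
  have ha : 0 < a := lt_min ha₁ ha₂
  have hΨa : ∀ R < a, ∀ θ, Ψ R θ = 0 := fun R hR θ => hva₁ (R, θ) (hR.trans_le (min_le_left _ _))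
  have hΦa : ∀ R < a, ∀ θ, Φ R θ = 0 := fun R hR θ => hva₂ (R, θ) (hR.trans_le (min_le_right _ _))
  have hΦb : ∀ R, b < R → ∀ θ, Φ R θ = 0 := fun R hR θ => hb R hR.le θ
  -- the graph components, explicitly
  have g10 : ∀ p : ℝ × ℝ, graphFn α χ₁ 0 p = Ψ p.1 p.2 := fun p => by rw [hΨ]; rfl
  have g20 : ∀ p : ℝ × ℝ, graphFn α χ₂ 0 p = Φ p.1 p.2 := fun p => by rw [hΦ]; rfl
  have g11 : ∀ p : ℝ × ℝ, graphFn α χ₁ 1 p = α * (p.1 * dz Ψ p.1 p.2) := fun p => by rw [hΨ, dz_cosProfile h11]; rfl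
  have g21 : ∀ p : ℝ × ℝ, graphFn α χ₂ 1 p = α * (p.1 * dz Φ p.1 p.2) := fun p => by rw [hΦ, dz_cosProfile h2]; rfl
  have g12 : ∀ p : ℝ × ℝ, graphFn α χ₁ 2 p = dθ Ψ p.1 p.2 := fun p => by rw [hΨ, dθ_cosProfile h11]; rfl
  have g22 : ∀ p : ℝ × ℝ, graphFn α χ₂ 2 p = dθ Φ p.1 p.2 := fun p => by rw [hΦ, dθ_cosProfile h2]; rfl
  have g13 : ∀ p : ℝ × ℝ, graphFn α χ₁ 3 p = Real.sin p.2 * χ₁ p.1 p.2 := fun p => rfl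
  ----------------------------------------------------------------
  -- the five terms of `L(Ψ)Φ` on the strip
  ----------------------------------------------------------------
  obtain ⟨Sχ, hSχ⟩ : ∃ Sχ : ℝ → ℝ → ℝ, Sχ = fun R θ => Real.sin θ * χ₁ R θ := ⟨_, rfl⟩
  have hS1 : ContDiff ℝ 1 (uncurry Sχ) := by
    rw [hSχ]
    have e : uncurry (fun R θ => Real.sin θ * χ₁ R θ) = fun p : ℝ × ℝ => Real.sin p.2 * uncurry χ₁ p := by funext p; rfl
    rw [e]; exact (Real.contDiff_sin.comp contDiff_snd).mul h11
  have cdθS : Continuous fun p : ℝ × ℝ => dθ Sχ p.1 p.2 := (contDiff_dθ_of_contDiff (n := 0) hS1).continuous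
  have hLp : ∀ p ∈ strip, ellipticOp α Ψ p.1 p.2 * graphFn α χ₂ 0 p =
      α ^ 2 * (-(p.1 ^ 2 * dz (dz Ψ) p.1 p.2) * Φ p.1 p.2) + α * (5 + α) * (-(p.1 * dz Ψ p.1 p.2) * Φ p.1 p.2) +
        (-dθ (dθ Ψ) p.1 p.2 * Φ p.1 p.2) + dθ Sχ p.1 p.2 * Φ p.1 p.2 - 6 * (Ψ p.1 p.2 * Φ p.1 p.2) := by
    intro p hp
    rw [g20 p]
    have ht : dθ (fun R θ => Real.tan θ * Ψ R θ) p.1 p.2 = dθ Sχ p.1 p.2 := by rw [hSχ]; exact dθ_tan_cosProfile hΨ hp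
    unfold ellipticOp
    rw [ht]; ring
  -- integrability (continuous, compactly supported through `Φ`)
  have iA : Integrable fun p : ℝ × ℝ => -(p.1 ^ 2 * dz (dz Ψ) p.1 p.2) * Φ p.1 p.2 :=
    ((by fun_prop : Continuous fun p : ℝ × ℝ => -(p.1 ^ 2 * dz (dz Ψ) p.1 p.2)).mul cΦ).integrable_of_hasCompactSupport sΦ.mul_left
  have iBm : Integrable fun p : ℝ × ℝ => -(p.1 * dz Ψ p.1 p.2) * Φ p.1 p.2 :=
    ((by fun_prop : Continuous fun p : ℝ × ℝ => -(p.1 * dz Ψ p.1 p.2)).mul cΦ).integrable_of_hasCompactSupport sΦ.mul_left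
  have iB : Integrable fun p : ℝ × ℝ => (p.1 * dz Ψ p.1 p.2) * Φ p.1 p.2 :=
    ((by fun_prop : Continuous fun p : ℝ × ℝ => p.1 * dz Ψ p.1 p.2).mul cΦ).integrable_of_hasCompactSupport sΦ.mul_left
  have iC : Integrable fun p : ℝ × ℝ => -dθ (dθ Ψ) p.1 p.2 * Φ p.1 p.2 :=
    ((by fun_prop : Continuous fun p : ℝ × ℝ => -dθ (dθ Ψ) p.1 p.2).mul cΦ).integrable_of_hasCompactSupport sΦ.mul_left
  have iD : Integrable fun p : ℝ × ℝ => dθ Sχ p.1 p.2 * Φ p.1 p.2 := (cdθS.mul cΦ).integrable_of_hasCompactSupport sΦ.mul_left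
  have iE : Integrable fun p : ℝ × ℝ => Ψ p.1 p.2 * Φ p.1 p.2 := (cΨ.mul cΦ).integrable_of_hasCompactSupport sΦ.mul_left
  have iZ : Integrable fun p : ℝ × ℝ => (p.1 * dz Ψ p.1 p.2) * (p.1 * dz Φ p.1 p.2) :=
    ((by fun_prop : Continuous fun p : ℝ × ℝ => p.1 * dz Ψ p.1 p.2).mul (by fun_prop : Continuous fun p : ℝ × ℝ => p.1 * dz Φ p.1 p.2)).integrable_of_hasCompactSupport
      (sdzΦ.mul_left (f := fun p : ℝ × ℝ => p.1)).mul_left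
  have iY : Integrable fun p : ℝ × ℝ => dθ Ψ p.1 p.2 * dθ Φ p.1 p.2 := (cdθΨ.mul cdθΦ).integrable_of_hasCompactSupport sdθΦ.mul_left
  have iT : Integrable fun p : ℝ × ℝ => (Real.sin p.2 * χ₁ p.1 p.2) * dθ Φ p.1 p.2 :=
    ((by fun_prop : Continuous fun p : ℝ × ℝ => Real.sin p.2 * χ₁ p.1 p.2).mul cdθΦ).integrable_of_hasCompactSupport sdθΦ.mul_left
  ----------------------------------------------------------------
  -- slice tools
  ----------------------------------------------------------------
  have hdzΦa : ∀ R < a, ∀ θ, dz Φ R θ = 0 := fun R hR θ => by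
    show deriv (fun R' => Φ R' θ) R = 0
    have h0 : (fun R' => Φ R' θ) =ᶠ[𝓝 R] fun _ => 0 := Filter.eventuallyEq_of_mem (Iio_mem_nhds hR) fun x hx => hΦa x hx θ
    rw [h0.deriv_eq, deriv_const]
  have hdzΦb : ∀ R, b < R → ∀ θ, dz Φ R θ = 0 := fun R hR θ => by
    show deriv (fun R' => Φ R' θ) R = 0
    have h0 : (fun R' => Φ R' θ) =ᶠ[𝓝 R] fun _ => 0 := Filter.eventuallyEq_of_mem (Ioi_mem_nhds hR) fun x hx => hΦb x hx θ
    rw [h0.deriv_eq, deriv_const]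
  have sliceR : ∀ {g : ℝ → ℝ}, Continuous g → (∀ R < a, g R = 0) → (∀ R, b < R → g R = 0) → IntegrableOn g (Ioi 0) := by
    intro g hg h1 h2
    have hs : HasCompactSupport g :=
      HasCompactSupport.of_support_subset_isCompact (isCompact_Icc (a := a) (b := b)) fun R hR => by
        by_contra h
        simp only [Set.mem_Icc, not_and_or, not_le] at h
        rcases h with h | h
        · exact hR (h1 R h)
        · exact hR (h2 R h)
    exact (hg.integrable_of_hasCompactSupport hs).integrableOn
  have sliceθ : ∀ {g : ℝ → ℝ}, Continuous g → IntegrableOn g (Ioo 0 (π / 2)) := fun {g} hg =>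
    (hg.continuousOn.integrableOn_Icc (a := 0) (b := π / 2)).mono_set Ioo_subset_Icc_self
  ----------------------------------------------------------------
  -- (i) radial IBP: `∫∫ −R²Ψ_RRΦ = ∫∫ (RΨ_R RΦ_R + 2RΨ_RΦ)`
  ----------------------------------------------------------------
  have hI : (∫ p in strip, -(p.1 ^ 2 * dz (dz Ψ) p.1 p.2) * Φ p.1 p.2) =
      ∫ p in strip, ((p.1 * dz Ψ p.1 p.2) * (p.1 * dz Φ p.1 p.2) + 2 * ((p.1 * dz Ψ p.1 p.2) * Φ p.1 p.2)) := by
    have iZB : Integrable fun p : ℝ × ℝ => (p.1 * dz Ψ p.1 p.2) * (p.1 * dz Φ p.1 p.2) + 2 * ((p.1 * dz Ψ p.1 p.2) * Φ p.1 p.2) := iZ.add (iB.const_mul _)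
    rw [integral_strip_eq_integral_Ioo_integral_Ioi iA, integral_strip_eq_integral_Ioo_integral_Ioi iZB]
    refine setIntegral_congr_fun measurableSet_Ioo fun θ _ => ?_
    have hu : ContDiff ℝ 2 fun R => Ψ R θ := hΨ2.comp (contDiff_id.prodMk contDiff_const)
    have hv : ContDiff ℝ 1 fun R => Φ R θ := hΦ1.comp (contDiff_id.prodMk contDiff_const)
    have key := integral_Ioi_neg_sq_mul_deriv2_mul_bilin hu hv ha (fun R hR => hΨa R hR θ) (fun R hR => hΦa R hR θ)
      (fun R hR => hΦb R hR θ)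
    have e1 : deriv (fun R => Ψ R θ) = fun R => dz Ψ R θ := rfl
    have e2 : deriv (fun R => dz Ψ R θ) = fun R => dz (dz Ψ) R θ := rfl
    have e3 : deriv (fun R => Φ R θ) = fun R => dz Φ R θ := rfl
    rw [e1, e2, e3] at key
    simp only [] at key
    have jZ : IntegrableOn (fun R => (R * dz Ψ R θ) * (R * dz Φ R θ)) (Ioi 0) :=
      sliceR (by have := cdzΨ.comp (Continuous.prodMk_right θ); have := cdzΦ.comp (Continuous.prodMk_right θ); fun_prop)
        (fun R hR => by simp [hdzΦa R hR θ]) fun R hR => by simp [hdzΦb R hR θ]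
    have jB : IntegrableOn (fun R => 2 * ((R * dz Ψ R θ) * Φ R θ)) (Ioi 0) :=
      sliceR (by have := cdzΨ.comp (Continuous.prodMk_right θ); have := cΦ.comp (Continuous.prodMk_right θ); fun_prop)
        (fun R hR => by simp [hΦa R hR θ]) fun R hR => by simp [hΦb R hR θ]
    rw [integral_add jZ jB, MeasureTheory.integral_const_mul]
    exact key
  ----------------------------------------------------------------
  -- (ii) angular IBP: `∫∫ −Ψ_θθΦ = ∫∫ Ψ_θΦ_θ`
  ----------------------------------------------------------------
  have hII : (∫ p in strip, -dθ (dθ Ψ) p.1 p.2 * Φ p.1 p.2) = ∫ p in strip, dθ Ψ p.1 p.2 * dθ Φ p.1 p.2 := by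
    rw [integral_strip_eq_integral_Ioi_integral_Ioo iC, integral_strip_eq_integral_Ioi_integral_Ioo iY]
    refine setIntegral_congr_fun measurableSet_Ioi fun R _ => ?_
    have hu : ContDiff ℝ 2 fun θ => Ψ R θ := hΨ2.comp (contDiff_const.prodMk contDiff_id)
    have hw : ContDiff ℝ 1 fun θ => Φ R θ := hΦ1.comp (contDiff_const.prodMk contDiff_id)
    have key := integral_Ioo_neg_deriv2_mul_bilin hu hw (hΦ0 R) (hΦ1' R)
    have e1 : deriv (fun θ => Ψ R θ) = fun θ => dθ Ψ R θ := rfl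
    have e2 : deriv (fun θ => dθ Ψ R θ) = fun θ => dθ (dθ Ψ) R θ := rfl
    have e3 : deriv (fun θ => Φ R θ) = fun θ => dθ Φ R θ := rfl
    rw [e1, e2, e3] at key
    exact key
  ----------------------------------------------------------------
  -- (iii) the `tan` term: `∫∫ ∂_θ(sinθχ₁)Φ = −∫∫ sinθχ₁ ∂_θΦ`
  ----------------------------------------------------------------
  have hIII : (∫ p in strip, dθ Sχ p.1 p.2 * Φ p.1 p.2) = -∫ p in strip, (Real.sin p.2 * χ₁ p.1 p.2) * dθ Φ p.1 p.2 := by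
    rw [integral_strip_eq_integral_Ioi_integral_Ioo iD, integral_strip_eq_integral_Ioi_integral_Ioo iT, ← MeasureTheory.integral_neg]
    refine setIntegral_congr_fun measurableSet_Ioi fun R _ => ?_
    have k1 : ContDiff ℝ 1 fun θ => χ₁ R θ := h11.comp (contDiff_const.prodMk contDiff_id)
    have k2 : ContDiff ℝ 1 fun θ => χ₂ R θ := h2.comp (contDiff_const.prodMk contDiff_id)
    have key := integral_Ioo_deriv_sinMul_mul_cosMul k1 k2
    have e1 : ∀ θ, deriv (fun θ => Real.sin θ * χ₁ R θ) θ = dθ Sχ R θ := fun θ => by rw [hSχ]; rfl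
    have e2 : (fun θ => Real.cos θ * χ₂ R θ) = fun θ => Φ R θ := by rw [hΦ]
    rw [e2] at key
    have e3 : ∀ θ, deriv (fun θ => Φ R θ) θ = dθ Φ R θ := fun θ => rfl
    have e4 : ∀ θ, Real.cos θ * χ₂ R θ = Φ R θ := fun θ => by rw [hΦ]
    simp only [e1, e3, e4] at key
    exact key
  ----------------------------------------------------------------
  -- assembly
  ----------------------------------------------------------------
  have eL : (∫ p in strip, ellipticOp α Ψ p.1 p.2 * graphFn α χ₂ 0 p) =
      α ^ 2 * (∫ p in strip, -(p.1 ^ 2 * dz (dz Ψ) p.1 p.2) * Φ p.1 p.2) +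
      α * (5 + α) * (∫ p in strip, -(p.1 * dz Ψ p.1 p.2) * Φ p.1 p.2) +
      (∫ p in strip, -dθ (dθ Ψ) p.1 p.2 * Φ p.1 p.2) + (∫ p in strip, dθ Sχ p.1 p.2 * Φ p.1 p.2) -
      6 * ∫ p in strip, Ψ p.1 p.2 * Φ p.1 p.2 := by
    rw [setIntegral_congr_fun measurableSet_strip hLp]
    have k1 : IntegrableOn (fun p : ℝ × ℝ => α ^ 2 * (-(p.1 ^ 2 * dz (dz Ψ) p.1 p.2) * Φ p.1 p.2)) strip := (iA.const_mul _).integrableOn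
    have k2 : IntegrableOn (fun p : ℝ × ℝ => α * (5 + α) * (-(p.1 * dz Ψ p.1 p.2) * Φ p.1 p.2)) strip := (iBm.const_mul _).integrableOn
    have k12 : IntegrableOn (fun p : ℝ × ℝ => α ^ 2 * (-(p.1 ^ 2 * dz (dz Ψ) p.1 p.2) * Φ p.1 p.2) +
        α * (5 + α) * (-(p.1 * dz Ψ p.1 p.2) * Φ p.1 p.2)) strip := k1.add k2
    have k123 : IntegrableOn (fun p : ℝ × ℝ => α ^ 2 * (-(p.1 ^ 2 * dz (dz Ψ) p.1 p.2) * Φ p.1 p.2) +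
        α * (5 + α) * (-(p.1 * dz Ψ p.1 p.2) * Φ p.1 p.2) + (-dθ (dθ Ψ) p.1 p.2 * Φ p.1 p.2)) strip := k12.add iC.integrableOn
    have k1234 : IntegrableOn (fun p : ℝ × ℝ => α ^ 2 * (-(p.1 ^ 2 * dz (dz Ψ) p.1 p.2) * Φ p.1 p.2) +
        α * (5 + α) * (-(p.1 * dz Ψ p.1 p.2) * Φ p.1 p.2) + (-dθ (dθ Ψ) p.1 p.2 * Φ p.1 p.2) + dθ Sχ p.1 p.2 * Φ p.1 p.2) strip :=
      k123.add iD.integrableOn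
    rw [integral_sub k1234 (iE.const_mul _).integrableOn, integral_add k123 iD.integrableOn, integral_add k12 iC.integrableOn,
      integral_add k1 k2, MeasureTheory.integral_const_mul, MeasureTheory.integral_const_mul, MeasureTheory.integral_const_mul]
  have eR : (∫ p in strip, (graphFn α χ₁ 1 p * graphFn α χ₂ 1 p + (α - 5) * (graphFn α χ₁ 1 p * graphFn α χ₂ 0 p) +
        graphFn α χ₁ 2 p * graphFn α χ₂ 2 p - graphFn α χ₁ 3 p * graphFn α χ₂ 2 p - 6 * (graphFn α χ₁ 0 p * graphFn α χ₂ 0 p))) =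
      α ^ 2 * (∫ p in strip, (p.1 * dz Ψ p.1 p.2) * (p.1 * dz Φ p.1 p.2)) + (α - 5) * α * (∫ p in strip, (p.1 * dz Ψ p.1 p.2) * Φ p.1 p.2) +
      (∫ p in strip, dθ Ψ p.1 p.2 * dθ Φ p.1 p.2) - (∫ p in strip, (Real.sin p.2 * χ₁ p.1 p.2) * dθ Φ p.1 p.2) -
      6 * ∫ p in strip, Ψ p.1 p.2 * Φ p.1 p.2 := by
    have hpt : ∀ p : ℝ × ℝ, graphFn α χ₁ 1 p * graphFn α χ₂ 1 p + (α - 5) * (graphFn α χ₁ 1 p * graphFn α χ₂ 0 p) +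
        graphFn α χ₁ 2 p * graphFn α χ₂ 2 p - graphFn α χ₁ 3 p * graphFn α χ₂ 2 p - 6 * (graphFn α χ₁ 0 p * graphFn α χ₂ 0 p) =
        α ^ 2 * ((p.1 * dz Ψ p.1 p.2) * (p.1 * dz Φ p.1 p.2)) + (α - 5) * α * ((p.1 * dz Ψ p.1 p.2) * Φ p.1 p.2) +
        dθ Ψ p.1 p.2 * dθ Φ p.1 p.2 - (Real.sin p.2 * χ₁ p.1 p.2) * dθ Φ p.1 p.2 - 6 * (Ψ p.1 p.2 * Φ p.1 p.2) := by
      intro p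
      rw [g10, g20, g11, g21, g12, g22, g13]; ring
    rw [integral_congr_ae (ae_of_all _ hpt)]
    have k1 : IntegrableOn (fun p : ℝ × ℝ => α ^ 2 * ((p.1 * dz Ψ p.1 p.2) * (p.1 * dz Φ p.1 p.2))) strip := (iZ.const_mul _).integrableOn
    have k2 : IntegrableOn (fun p : ℝ × ℝ => (α - 5) * α * ((p.1 * dz Ψ p.1 p.2) * Φ p.1 p.2)) strip := (iB.const_mul _).integrableOn
    have k12 : IntegrableOn (fun p : ℝ × ℝ => α ^ 2 * ((p.1 * dz Ψ p.1 p.2) * (p.1 * dz Φ p.1 p.2)) + (α - 5) * α * ((p.1 * dz Ψ p.1 p.2) * Φ p.1 p.2)) strip :=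
      k1.add k2
    have k123 : IntegrableOn (fun p : ℝ × ℝ => α ^ 2 * ((p.1 * dz Ψ p.1 p.2) * (p.1 * dz Φ p.1 p.2)) + (α - 5) * α * ((p.1 * dz Ψ p.1 p.2) * Φ p.1 p.2) +
        dθ Ψ p.1 p.2 * dθ Φ p.1 p.2) strip := k12.add iY.integrableOn
    have k1234 : IntegrableOn (fun p : ℝ × ℝ => α ^ 2 * ((p.1 * dz Ψ p.1 p.2) * (p.1 * dz Φ p.1 p.2)) + (α - 5) * α * ((p.1 * dz Ψ p.1 p.2) * Φ p.1 p.2) +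
        dθ Ψ p.1 p.2 * dθ Φ p.1 p.2 - (Real.sin p.2 * χ₁ p.1 p.2) * dθ Φ p.1 p.2) strip := k123.sub iT.integrableOn
    rw [integral_sub k1234 (iE.const_mul _).integrableOn, integral_sub k123 iT.integrableOn, integral_add k12 iY.integrableOn,
      integral_add k1 k2, MeasureTheory.integral_const_mul, MeasureTheory.integral_const_mul, MeasureTheory.integral_const_mul]
  have hIsplit : (∫ p in strip, ((p.1 * dz Ψ p.1 p.2) * (p.1 * dz Φ p.1 p.2) + 2 * ((p.1 * dz Ψ p.1 p.2) * Φ p.1 p.2))) =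
      (∫ p in strip, (p.1 * dz Ψ p.1 p.2) * (p.1 * dz Φ p.1 p.2)) + 2 * ∫ p in strip, (p.1 * dz Ψ p.1 p.2) * Φ p.1 p.2 := by
    rw [integral_add iZ.integrableOn (iB.const_mul _).integrableOn, MeasureTheory.integral_const_mul]
  have hBm : (∫ p in strip, -(p.1 * dz Ψ p.1 p.2) * Φ p.1 p.2) = -∫ p in strip, (p.1 * dz Ψ p.1 p.2) * Φ p.1 p.2 := by
    rw [← MeasureTheory.integral_neg]; exact integral_congr_ae (ae_of_all _ fun p => by ring)
  rw [eL, eR, hI, hIsplit, hII, hIII, hBm]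
  ring

/-- **Green's identity in the energy space**: `∫∫_strip L(Ψ)·Φ = B(Jχ₁, Jχ₂)` under the hypotheses of
`integral_strip_ellipticOp_mul_eq_weak`. [cite: Elgindi2021, §7.1 proof of Proposition 7.1, Step 2 (p. 19 of arXiv:1904.04795)] -/
theorem integral_strip_ellipticOp_mul_eq_energyForm (α : ℝ) {χ₁ χ₂ : ℝ → ℝ → ℝ} (h1 : ContDiff ℝ 2 (uncurry χ₁))
    (hs1 : HasCompactSupport (uncurry χ₁)) (hpos1 : ∀ p ∈ tsupport (uncurry χ₁), 0 < p.1)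
    (h2 : ContDiff ℝ 1 (uncurry χ₂)) (hs2 : HasCompactSupport (uncurry χ₂)) (hpos2 : ∀ p ∈ tsupport (uncurry χ₂), 0 < p.1)
    (h20 : ∀ R, χ₂ R 0 = 0) {Ψ : ℝ → ℝ → ℝ} (hΨ : Ψ = fun R θ => Real.cos θ * χ₁ R θ) :
    ∫ p in strip, ellipticOp α Ψ p.1 p.2 * graphFn α χ₂ 0 p = energyForm α (graphElt α χ₁) (graphElt α χ₂) := by
  rw [integral_strip_ellipticOp_mul_eq_weak α h1 hs1 hpos1 h2 hs2 hpos2 h20 hΨ,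
    energyForm_graphElt (h1.of_le (by norm_num)) hs1 h2 hs2]

end Elgindi

end Literature.Analysis.FluidPDE
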